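import Literature.Algebra.Polynomial.CasasAlvero.Char557Digits
import Literature.Algebra.Polynomial.CasasAlvero.Char557DigitsHigh
import Literature.Algebra.Polynomial.CasasAlvero.Char557DigitsTop
import Literature.Algebra.Polynomial.CasasAlvero.Char557DigitsPeak
import Literature.Algebra.Polynomial.CasasAlvero.Degree7Char557
import Literature.Algebra.Polynomial.CasasAlvero.Pentanomial
import Literature.Algebra.Polynomial.CasasAlvero.Degree6CandidatesPrime
import Literature.Algebra.Polynomial.CasasAlvero.FieldCorollaries
import Literature.Algebra.Polynomial.CasasAlvero.Degree5
import Literature.Algebra.Polynomial.CasasAlvero.Degree6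
import Literature.Algebra.Polynomial.CasasAlvero.DigitReduction
import HarnessLib

/-!
# Casas-Alvero degrees in characteristic 557: the classification away from the digit `8`

Over EVERY field `K` of characteristic `557` and for every degree `d` that is NOT of the form `8·557^k`:
`CA_d(K) ⟺ d = 0 ∨ d = a·557^k` with `1 ≤ a ≤ 7`.  The one digit left out of this file is `a = 8`, for the following reason.  Every bad digit in this
tree is refuted by an explicit `𝔽_p`-rational sparse polynomial with `𝔽_p`-rational witnesses (which lives in every field of characteristic `p`), but the
EXHAUSTIVE search of the translated–scaled normal form `X^8 + a_6 X^6 + … + a_1 X` over `𝔽_557`, in the exhaustive support-enumeration implementation `cls/wsub/wsub.py 557:8` (every support of size `≤ 6`,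
witness-subset linear algebra; two independent runs; kit jobs j145873, j149358), returns NOTHING: there is no Casas-Alvero octic over `𝔽_557` all of whose Hasse-derivative witnesses lie in
`𝔽_557`.  Consequently `CA_8` cannot be refuted uniformly over all fields of characteristic `557` by this method (indeed the search says that `CA_8` holds over
the prime field `𝔽_557` itself — a computational statement NOT formalised here), and whether `CA_8` holds over the algebraic closure of `𝔽_557` (whether `557`
is a good prime of degree `8` in the sense of [CastryckLaterveerOunaies2012]) is decided SEPARATELY, in the affirmative, by the `876` kernel-checked scenario certificates of `Degree8Char557Cert01.lean` … `Degree8Char557Cert18.lean` assembled in `Degree8Char557.lean` (`holdsInDegree_eight_of_char_557`: `CA_8` HOLDS over every field of characteristic `557`, so `557` is a GOOD prime for degree `8` and the digit `8` is genuinely positive — which is why no refuting example can exist); `CharFiveHundredFiftySevenComplete.lean` combines that theorem with this file into the complete classification (digit set `{1, 2, 3, 4, 5, 6, 7, 8}`).  This file is the example-based half and carves the digit `8` out.  Nothing below depends on the outcome.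
Ingredients: the digit reduction `CA_d ⇒ d = a·p^k ∧ CA_a` (`DigitReduction.lean`, any field); the positive digits `1, 2, 3, 4`
([GrafVonBothmerEtAl2007, Props. 2, 6]), `5` (`Degree5.lean`: `557` is not one of the nine bad primes of degree `5`), `6` (`557` is not among the `54`
candidate bad primes of degree `6` of `Degree6CandidatesPrime.lean`, so `CA_6` holds in characteristic `557` [CastryckLaterveerOunaies2012, Thm. 4]) and `7`
(`Degree7Char557.lean`: `557` is a GOOD prime for degree `7` — the kernel-checked scenario certificates `holdsInDegree_seven_of_char_557`; the bad primes of
degree `7` were computed in [CastryckLaterveerOunaies2012, Thm. 4]); and a refutation of every digit `9 ≤ a ≤ 556` over every field of characteristic `557`: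
`30, 53, 80, 110, 111, 116, 120, 135, 143, 153, 155, 161, 165, 168, 172, 207, 213, 221, 223, 225, 228, 231, 232, 233, 235, 236, 246, 247, 250, 251, 252, 257, 258, 264, 265, 271, 277, 279, 284, 287, 291, 293, 298, 309, 315, 320, 323, 326, 328, 335, 337, 341, 342, 343, 345, 346, 354, 355, 361, 363, 364, 368, 374, 375, 378, 380, 381, 384, 385, 391, 395, 398, 401, 407, 410, 415, 418, 419, 423, 427, 429, 431, 438, 439, 441, 446, 447, 451, 453, 455, 461, 463, 465, 468, 469, 470, 473, 475, 476, 479, 482, 483, 484, 488, 489, 491, 492, 494, 496, 497, 499, 506, 508, 509, 510, 513, 514, 515, 516, 517, 519, 524, 530, 534, 540, 542, 543, 544, 548, 556` by the binomial criterion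
(`m = 14, 12, 8, 42, 20, 48, 46, 37, 70, 26, 60, 60, 4, 80, 86, 36, 20, 88, 65, 103, 40, 114, 60, 38, 87, 67, 64, 67, 61, 59, 83, 46, 22, 50, 115, 109, 84, 10, 67, 10, 110, 13, 37, 47, 67, 22, 39, 5, 61, 91, 141, 146, 50, 93, 46, 103, 45, 41, 38, 20, 19, 40, 64, 110, 39, 19, 134, 60, 36, 81, 4, 195, 83, 117, 121, 196, 103, 98, 88, 43, 26, 195, 101, 114, 150, 179, 162, 221, 122, 60, 60, 213, 20, 80, 148, 86, 67, 165, 41, 156, 46, 70, 8, 42, 83, 158, 182, 169, 172, 192, 150, 214, 68, 247, 74, 129, 68, 12, 188, 233, 13, 231, 37, 236, 14, 16, 37, 51, 72, 2`); and the 418 remaining digits by the sparse `𝔽_557`-examples of `Char557Digits.lean`, `Char557DigitsHigh.lean`, `Char557DigitsTop.lean` and `Char557DigitsPeak.lean`.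
-/

noncomputable section

open Polynomial

set_option maxRecDepth 8192

namespace Literature.Algebra.Polynomial.CasasAlvero

section CharFiveHundredFiftySevenPartial

variable (K : Type*) [Field K] [CharP K 557]

/-- `CA_{6·557^k}` over every field of characteristic `557` (`CA_6` itself — the case `k = 0` — holds because `557` is not among the
`54` candidate bad primes of degree `6` of `Degree6CandidatesPrime.lean`, `holdsInDegree_six_of_not_mem`, i.e. `557` is a GOOD prime for degree `6`
[cite: CastryckLaterveerOunaies2012, Thm. 4]). [cite: GrafVonBothmerEtAl2007, Prop. 6] -/
theorem holdsInDegree_six_mul_pow_of_char_557' (k : ℕ) : HoldsInDegree K (6 * 557 ^ k) := by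
  haveI : Fact (Nat.Prime 557) := ⟨by norm_num⟩
  exact holdsInDegree_mul_prime_pow_field K 557 (holdsInDegree_six_of_not_mem (K := AlgebraicClosure K) 557 (by decide)) k

set_option maxHeartbeats 0 in
/-- every digit `9 ≤ a < 557` other than `8` fails: `¬ CA_a` over every field of characteristic `557` — the bad-prime computations of
[cite: CastryckLaterveerOunaies2012, Thm. 4] (degrees `≤ 7`) extended to these digits by explicit `𝔽_557`-rational examples and the
binomial criterion (the digit `8` has no `𝔽_557`-rational-witness example and is not treated). [cite: GrafVonBothmerEtAl2007, Prop. 6] -/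
theorem not_holdsInDegree_digit_of_char_fiveHundredFiftySeven' {a : ℕ} (hlo : 9 ≤ a) (hap : a < 557) (h8 : a ≠ 8) : ¬ HoldsInDegree K a := by
  haveI : Fact (Nat.Prime 557) := ⟨by norm_num⟩
  interval_cases a
  · exact not_holdsInDegree_nine_of_char_557 K
  · exact not_holdsInDegree_ten_of_char_557 K
  · exact not_holdsInDegree_eleven_of_char_557 K
  · exact not_holdsInDegree_twelve_of_char_557 K
  · exact not_holdsInDegree_thirteen_of_char_557 K
  · exact not_holdsInDegree_fourteen_of_char_557 K
  · exact not_holdsInDegree_fifteen_of_char_557 K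
  · exact not_holdsInDegree_sixteen_of_char_557 K
  · exact not_holdsInDegree_seventeen_of_char_557 K
  · exact not_holdsInDegree_eighteen_of_char_557 K
  · exact not_holdsInDegree_nineteen_of_char_557 K
  · exact not_holdsInDegree_twenty_of_char_557 K
  · exact not_holdsInDegree_twentyOne_of_char_557 K
  · exact not_holdsInDegree_twentyTwo_of_char_557 K
  · exact not_holdsInDegree_twentyThree_of_char_557 K
  · exact not_holdsInDegree_twentyFour_of_char_557 K
  · exact not_holdsInDegree_twentyFive_of_char_557 K
  · exact not_holdsInDegree_twentySix_of_char_557 K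
  · exact not_holdsInDegree_twentySeven_of_char_557 K
  · exact not_holdsInDegree_twentyEight_of_char_557 K
  · exact not_holdsInDegree_twentyNine_of_char_557 K
  · exact not_holdsInDegree_of_choose_modEq_one K 557 (d := 30) (m := 14) (by norm_num) (by norm_num) (by decide)
  · exact not_holdsInDegree_thirtyOne_of_char_557 K
  · exact not_holdsInDegree_thirtyTwo_of_char_557 K
  · exact not_holdsInDegree_thirtyThree_of_char_557 K
  · exact not_holdsInDegree_thirtyFour_of_char_557 K
  · exact not_holdsInDegree_thirtyFive_of_char_557 K
  · exact not_holdsInDegree_thirtySix_of_char_557 K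
  · exact not_holdsInDegree_thirtySeven_of_char_557 K
  · exact not_holdsInDegree_thirtyEight_of_char_557 K
  · exact not_holdsInDegree_thirtyNine_of_char_557 K
  · exact not_holdsInDegree_forty_of_char_557 K
  · exact not_holdsInDegree_fortyOne_of_char_557 K
  · exact not_holdsInDegree_fortyTwo_of_char_557 K
  · exact not_holdsInDegree_fortyThree_of_char_557 K
  · exact not_holdsInDegree_fortyFour_of_char_557 K
  · exact not_holdsInDegree_fortyFive_of_char_557 K
  · exact not_holdsInDegree_fortySix_of_char_557 K
  · exact not_holdsInDegree_fortySeven_of_char_557 K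
  · exact not_holdsInDegree_fortyEight_of_char_557 K
  · exact not_holdsInDegree_fortyNine_of_char_557 K
  · exact not_holdsInDegree_fifty_of_char_557 K
  · exact not_holdsInDegree_fiftyOne_of_char_557 K
  · exact not_holdsInDegree_fiftyTwo_of_char_557 K
  · exact not_holdsInDegree_of_choose_modEq_one K 557 (d := 53) (m := 12) (by norm_num) (by norm_num) (by decide)
  · exact not_holdsInDegree_fiftyFour_of_char_557 K
  · exact not_holdsInDegree_fiftyFive_of_char_557 K
  · exact not_holdsInDegree_fiftySix_of_char_557 K
  · exact not_holdsInDegree_fiftySeven_of_char_557 K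
  · exact not_holdsInDegree_fiftyEight_of_char_557 K
  · exact not_holdsInDegree_fiftyNine_of_char_557 K
  · exact not_holdsInDegree_sixty_of_char_557 K
  · exact not_holdsInDegree_sixtyOne_of_char_557 K
  · exact not_holdsInDegree_sixtyTwo_of_char_557 K
  · exact not_holdsInDegree_sixtyThree_of_char_557 K
  · exact not_holdsInDegree_sixtyFour_of_char_557 K
  · exact not_holdsInDegree_sixtyFive_of_char_557 K
  · exact not_holdsInDegree_sixtySix_of_char_557 K
  · exact not_holdsInDegree_sixtySeven_of_char_557 K
  · exact not_holdsInDegree_sixtyEight_of_char_557 K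
  · exact not_holdsInDegree_sixtyNine_of_char_557 K
  · exact not_holdsInDegree_seventy_of_char_557 K
  · exact not_holdsInDegree_seventyOne_of_char_557 K
  · exact not_holdsInDegree_seventyTwo_of_char_557 K
  · exact not_holdsInDegree_seventyThree_of_char_557 K
  · exact not_holdsInDegree_seventyFour_of_char_557 K
  · exact not_holdsInDegree_seventyFive_of_char_557 K
  · exact not_holdsInDegree_seventySix_of_char_557 K
  · exact not_holdsInDegree_seventySeven_of_char_557 K
  · exact not_holdsInDegree_seventyEight_of_char_557 K
  · exact not_holdsInDegree_seventyNine_of_char_557 K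
  · exact not_holdsInDegree_of_choose_modEq_one K 557 (d := 80) (m := 8) (by norm_num) (by norm_num) (by decide)
  · exact not_holdsInDegree_eightyOne_of_char_557 K
  · exact not_holdsInDegree_eightyTwo_of_char_557 K
  · exact not_holdsInDegree_eightyThree_of_char_557 K
  · exact not_holdsInDegree_eightyFour_of_char_557 K
  · exact not_holdsInDegree_eightyFive_of_char_557 K
  · exact not_holdsInDegree_eightySix_of_char_557 K
  · exact not_holdsInDegree_eightySeven_of_char_557 K
  · exact not_holdsInDegree_eightyEight_of_char_557 K
  · exact not_holdsInDegree_eightyNine_of_char_557 K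
  · exact not_holdsInDegree_ninety_of_char_557 K
  · exact not_holdsInDegree_ninetyOne_of_char_557 K
  · exact not_holdsInDegree_ninetyTwo_of_char_557 K
  · exact not_holdsInDegree_ninetyThree_of_char_557 K
  · exact not_holdsInDegree_ninetyFour_of_char_557 K
  · exact not_holdsInDegree_ninetyFive_of_char_557 K
  · exact not_holdsInDegree_ninetySix_of_char_557 K
  · exact not_holdsInDegree_ninetySeven_of_char_557 K
  · exact not_holdsInDegree_ninetyEight_of_char_557 K
  · exact not_holdsInDegree_ninetyNine_of_char_557 K
  · exact not_holdsInDegree_oneHundred_of_char_557 K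
  · exact not_holdsInDegree_oneHundredOne_of_char_557 K
  · exact not_holdsInDegree_oneHundredTwo_of_char_557 K
  · exact not_holdsInDegree_oneHundredThree_of_char_557 K
  · exact not_holdsInDegree_oneHundredFour_of_char_557 K
  · exact not_holdsInDegree_oneHundredFive_of_char_557 K
  · exact not_holdsInDegree_oneHundredSix_of_char_557 K
  · exact not_holdsInDegree_oneHundredSeven_of_char_557 K
  · exact not_holdsInDegree_oneHundredEight_of_char_557 K
  · exact not_holdsInDegree_oneHundredNine_of_char_557 K
  · exact not_holdsInDegree_of_choose_modEq_one K 557 (d := 110) (m := 42) (by norm_num) (by norm_num) (by decide)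
  · exact not_holdsInDegree_of_choose_modEq_one K 557 (d := 111) (m := 20) (by norm_num) (by norm_num) (by decide)
  · exact not_holdsInDegree_oneHundredTwelve_of_char_557 K
  · exact not_holdsInDegree_oneHundredThirteen_of_char_557 K
  · exact not_holdsInDegree_oneHundredFourteen_of_char_557 K
  · exact not_holdsInDegree_oneHundredFifteen_of_char_557 K
  · exact not_holdsInDegree_of_choose_modEq_one K 557 (d := 116) (m := 48) (by norm_num) (by norm_num) (by decide)
  · exact not_holdsInDegree_oneHundredSeventeen_of_char_557 K
  · exact not_holdsInDegree_oneHundredEighteen_of_char_557 K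
  · exact not_holdsInDegree_oneHundredNineteen_of_char_557 K
  · exact not_holdsInDegree_of_choose_modEq_one K 557 (d := 120) (m := 46) (by norm_num) (by norm_num) (by decide)
  · exact not_holdsInDegree_oneHundredTwentyOne_of_char_557 K
  · exact not_holdsInDegree_oneHundredTwentyTwo_of_char_557 K
  · exact not_holdsInDegree_oneHundredTwentyThree_of_char_557 K
  · exact not_holdsInDegree_oneHundredTwentyFour_of_char_557 K
  · exact not_holdsInDegree_oneHundredTwentyFive_of_char_557 K
  · exact not_holdsInDegree_oneHundredTwentySix_of_char_557 K
  · exact not_holdsInDegree_oneHundredTwentySeven_of_char_557 K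
  · exact not_holdsInDegree_oneHundredTwentyEight_of_char_557 K
  · exact not_holdsInDegree_oneHundredTwentyNine_of_char_557 K
  · exact not_holdsInDegree_oneHundredThirty_of_char_557 K
  · exact not_holdsInDegree_oneHundredThirtyOne_of_char_557 K
  · exact not_holdsInDegree_oneHundredThirtyTwo_of_char_557 K
  · exact not_holdsInDegree_oneHundredThirtyThree_of_char_557 K
  · exact not_holdsInDegree_oneHundredThirtyFour_of_char_557 K
  · exact not_holdsInDegree_of_choose_modEq_one K 557 (d := 135) (m := 37) (by norm_num) (by norm_num) (by decide)
  · exact not_holdsInDegree_oneHundredThirtySix_of_char_557 K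
  · exact not_holdsInDegree_oneHundredThirtySeven_of_char_557 K
  · exact not_holdsInDegree_oneHundredThirtyEight_of_char_557 K
  · exact not_holdsInDegree_oneHundredThirtyNine_of_char_557 K
  · exact not_holdsInDegree_oneHundredForty_of_char_557 K
  · exact not_holdsInDegree_oneHundredFortyOne_of_char_557 K
  · exact not_holdsInDegree_oneHundredFortyTwo_of_char_557 K
  · exact not_holdsInDegree_of_choose_modEq_one K 557 (d := 143) (m := 70) (by norm_num) (by norm_num) (by decide)
  · exact not_holdsInDegree_oneHundredFortyFour_of_char_557 K
  · exact not_holdsInDegree_oneHundredFortyFive_of_char_557 K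
  · exact not_holdsInDegree_oneHundredFortySix_of_char_557 K
  · exact not_holdsInDegree_oneHundredFortySeven_of_char_557 K
  · exact not_holdsInDegree_oneHundredFortyEight_of_char_557 K
  · exact not_holdsInDegree_oneHundredFortyNine_of_char_557 K
  · exact not_holdsInDegree_oneHundredFifty_of_char_557 K
  · exact not_holdsInDegree_oneHundredFiftyOne_of_char_557 K
  · exact not_holdsInDegree_oneHundredFiftyTwo_of_char_557 K
  · exact not_holdsInDegree_of_choose_modEq_one K 557 (d := 153) (m := 26) (by norm_num) (by norm_num) (by decide)
  · exact not_holdsInDegree_oneHundredFiftyFour_of_char_557 K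
  · exact not_holdsInDegree_of_choose_modEq_one K 557 (d := 155) (m := 60) (by norm_num) (by norm_num) (by decide)
  · exact not_holdsInDegree_oneHundredFiftySix_of_char_557 K
  · exact not_holdsInDegree_oneHundredFiftySeven_of_char_557 K
  · exact not_holdsInDegree_oneHundredFiftyEight_of_char_557 K
  · exact not_holdsInDegree_oneHundredFiftyNine_of_char_557 K
  · exact not_holdsInDegree_oneHundredSixty_of_char_557 K
  · exact not_holdsInDegree_of_choose_modEq_one K 557 (d := 161) (m := 60) (by norm_num) (by norm_num) (by decide)
  · exact not_holdsInDegree_oneHundredSixtyTwo_of_char_557 K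
  · exact not_holdsInDegree_oneHundredSixtyThree_of_char_557 K
  · exact not_holdsInDegree_oneHundredSixtyFour_of_char_557 K
  · exact not_holdsInDegree_of_choose_modEq_one K 557 (d := 165) (m := 4) (by norm_num) (by norm_num) (by decide)
  · exact not_holdsInDegree_oneHundredSixtySix_of_char_557 K
  · exact not_holdsInDegree_oneHundredSixtySeven_of_char_557 K
  · exact not_holdsInDegree_of_choose_modEq_one K 557 (d := 168) (m := 80) (by norm_num) (by norm_num) (by decide)
  · exact not_holdsInDegree_oneHundredSixtyNine_of_char_557 K
  · exact not_holdsInDegree_oneHundredSeventy_of_char_557 K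
  · exact not_holdsInDegree_oneHundredSeventyOne_of_char_557 K
  · exact not_holdsInDegree_of_choose_modEq_one K 557 (d := 172) (m := 86) (by norm_num) (by norm_num) (by decide)
  · exact not_holdsInDegree_oneHundredSeventyThree_of_char_557 K
  · exact not_holdsInDegree_oneHundredSeventyFour_of_char_557 K
  · exact not_holdsInDegree_oneHundredSeventyFive_of_char_557 K
  · exact not_holdsInDegree_oneHundredSeventySix_of_char_557 K
  · exact not_holdsInDegree_oneHundredSeventySeven_of_char_557 K
  · exact not_holdsInDegree_oneHundredSeventyEight_of_char_557 K
  · exact not_holdsInDegree_oneHundredSeventyNine_of_char_557 K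
  · exact not_holdsInDegree_oneHundredEighty_of_char_557 K
  · exact not_holdsInDegree_oneHundredEightyOne_of_char_557 K
  · exact not_holdsInDegree_oneHundredEightyTwo_of_char_557 K
  · exact not_holdsInDegree_oneHundredEightyThree_of_char_557 K
  · exact not_holdsInDegree_oneHundredEightyFour_of_char_557 K
  · exact not_holdsInDegree_oneHundredEightyFive_of_char_557 K
  · exact not_holdsInDegree_oneHundredEightySix_of_char_557 K
  · exact not_holdsInDegree_oneHundredEightySeven_of_char_557 K
  · exact not_holdsInDegree_oneHundredEightyEight_of_char_557 K
  · exact not_holdsInDegree_oneHundredEightyNine_of_char_557 K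
  · exact not_holdsInDegree_oneHundredNinety_of_char_557 K
  · exact not_holdsInDegree_oneHundredNinetyOne_of_char_557 K
  · exact not_holdsInDegree_oneHundredNinetyTwo_of_char_557 K
  · exact not_holdsInDegree_oneHundredNinetyThree_of_char_557 K
  · exact not_holdsInDegree_oneHundredNinetyFour_of_char_557 K
  · exact not_holdsInDegree_oneHundredNinetyFive_of_char_557 K
  · exact not_holdsInDegree_oneHundredNinetySix_of_char_557 K
  · exact not_holdsInDegree_oneHundredNinetySeven_of_char_557 K
  · exact not_holdsInDegree_oneHundredNinetyEight_of_char_557 K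
  · exact not_holdsInDegree_oneHundredNinetyNine_of_char_557 K
  · exact not_holdsInDegree_twoHundred_of_char_557 K
  · exact not_holdsInDegree_twoHundredOne_of_char_557 K
  · exact not_holdsInDegree_twoHundredTwo_of_char_557 K
  · exact not_holdsInDegree_twoHundredThree_of_char_557 K
  · exact not_holdsInDegree_twoHundredFour_of_char_557 K
  · exact not_holdsInDegree_twoHundredFive_of_char_557 K
  · exact not_holdsInDegree_twoHundredSix_of_char_557 K
  · exact not_holdsInDegree_of_choose_modEq_one K 557 (d := 207) (m := 36) (by norm_num) (by norm_num) (by decide)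
  · exact not_holdsInDegree_twoHundredEight_of_char_557 K
  · exact not_holdsInDegree_twoHundredNine_of_char_557 K
  · exact not_holdsInDegree_twoHundredTen_of_char_557 K
  · exact not_holdsInDegree_twoHundredEleven_of_char_557 K
  · exact not_holdsInDegree_twoHundredTwelve_of_char_557 K
  · exact not_holdsInDegree_of_choose_modEq_one K 557 (d := 213) (m := 20) (by norm_num) (by norm_num) (by decide)
  · exact not_holdsInDegree_twoHundredFourteen_of_char_557 K
  · exact not_holdsInDegree_twoHundredFifteen_of_char_557 K
  · exact not_holdsInDegree_twoHundredSixteen_of_char_557 K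
  · exact not_holdsInDegree_twoHundredSeventeen_of_char_557 K
  · exact not_holdsInDegree_twoHundredEighteen_of_char_557 K
  · exact not_holdsInDegree_twoHundredNineteen_of_char_557 K
  · exact not_holdsInDegree_twoHundredTwenty_of_char_557 K
  · exact not_holdsInDegree_of_choose_modEq_one K 557 (d := 221) (m := 88) (by norm_num) (by norm_num) (by decide)
  · exact not_holdsInDegree_twoHundredTwentyTwo_of_char_557 K
  · exact not_holdsInDegree_of_choose_modEq_one K 557 (d := 223) (m := 65) (by norm_num) (by norm_num) (by decide)
  · exact not_holdsInDegree_twoHundredTwentyFour_of_char_557 K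
  · exact not_holdsInDegree_of_choose_modEq_one K 557 (d := 225) (m := 103) (by norm_num) (by norm_num) (by decide)
  · exact not_holdsInDegree_twoHundredTwentySix_of_char_557 K
  · exact not_holdsInDegree_twoHundredTwentySeven_of_char_557 K
  · exact not_holdsInDegree_of_choose_modEq_one K 557 (d := 228) (m := 40) (by norm_num) (by norm_num) (by decide)
  · exact not_holdsInDegree_twoHundredTwentyNine_of_char_557 K
  · exact not_holdsInDegree_twoHundredThirty_of_char_557 K
  · exact not_holdsInDegree_of_choose_modEq_one K 557 (d := 231) (m := 114) (by norm_num) (by norm_num) (by decide)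
  · exact not_holdsInDegree_of_choose_modEq_one K 557 (d := 232) (m := 60) (by norm_num) (by norm_num) (by decide)
  · exact not_holdsInDegree_of_choose_modEq_one K 557 (d := 233) (m := 38) (by norm_num) (by norm_num) (by decide)
  · exact not_holdsInDegree_twoHundredThirtyFour_of_char_557 K
  · exact not_holdsInDegree_of_choose_modEq_one K 557 (d := 235) (m := 87) (by norm_num) (by norm_num) (by decide)
  · exact not_holdsInDegree_of_choose_modEq_one K 557 (d := 236) (m := 67) (by norm_num) (by norm_num) (by decide)
  · exact not_holdsInDegree_twoHundredThirtySeven_of_char_557 K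
  · exact not_holdsInDegree_twoHundredThirtyEight_of_char_557 K
  · exact not_holdsInDegree_twoHundredThirtyNine_of_char_557 K
  · exact not_holdsInDegree_twoHundredForty_of_char_557 K
  · exact not_holdsInDegree_twoHundredFortyOne_of_char_557 K
  · exact not_holdsInDegree_twoHundredFortyTwo_of_char_557 K
  · exact not_holdsInDegree_twoHundredFortyThree_of_char_557 K
  · exact not_holdsInDegree_twoHundredFortyFour_of_char_557 K
  · exact not_holdsInDegree_twoHundredFortyFive_of_char_557 K
  · exact not_holdsInDegree_of_choose_modEq_one K 557 (d := 246) (m := 64) (by norm_num) (by norm_num) (by decide)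
  · exact not_holdsInDegree_of_choose_modEq_one K 557 (d := 247) (m := 67) (by norm_num) (by norm_num) (by decide)
  · exact not_holdsInDegree_twoHundredFortyEight_of_char_557 K
  · exact not_holdsInDegree_twoHundredFortyNine_of_char_557 K
  · exact not_holdsInDegree_of_choose_modEq_one K 557 (d := 250) (m := 61) (by norm_num) (by norm_num) (by decide)
  · exact not_holdsInDegree_of_choose_modEq_one K 557 (d := 251) (m := 59) (by norm_num) (by norm_num) (by decide)
  · exact not_holdsInDegree_of_choose_modEq_one K 557 (d := 252) (m := 83) (by norm_num) (by norm_num) (by decide)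
  · exact not_holdsInDegree_twoHundredFiftyThree_of_char_557 K
  · exact not_holdsInDegree_twoHundredFiftyFour_of_char_557 K
  · exact not_holdsInDegree_twoHundredFiftyFive_of_char_557 K
  · exact not_holdsInDegree_twoHundredFiftySix_of_char_557 K
  · exact not_holdsInDegree_of_choose_modEq_one K 557 (d := 257) (m := 46) (by norm_num) (by norm_num) (by decide)
  · exact not_holdsInDegree_of_choose_modEq_one K 557 (d := 258) (m := 22) (by norm_num) (by norm_num) (by decide)
  · exact not_holdsInDegree_twoHundredFiftyNine_of_char_557 K
  · exact not_holdsInDegree_twoHundredSixty_of_char_557 K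
  · exact not_holdsInDegree_twoHundredSixtyOne_of_char_557 K
  · exact not_holdsInDegree_twoHundredSixtyTwo_of_char_557 K
  · exact not_holdsInDegree_twoHundredSixtyThree_of_char_557 K
  · exact not_holdsInDegree_of_choose_modEq_one K 557 (d := 264) (m := 50) (by norm_num) (by norm_num) (by decide)
  · exact not_holdsInDegree_of_choose_modEq_one K 557 (d := 265) (m := 115) (by norm_num) (by norm_num) (by decide)
  · exact not_holdsInDegree_twoHundredSixtySix_of_char_557 K
  · exact not_holdsInDegree_twoHundredSixtySeven_of_char_557 K
  · exact not_holdsInDegree_twoHundredSixtyEight_of_char_557 K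
  · exact not_holdsInDegree_twoHundredSixtyNine_of_char_557 K
  · exact not_holdsInDegree_twoHundredSeventy_of_char_557 K
  · exact not_holdsInDegree_of_choose_modEq_one K 557 (d := 271) (m := 109) (by norm_num) (by norm_num) (by decide)
  · exact not_holdsInDegree_twoHundredSeventyTwo_of_char_557 K
  · exact not_holdsInDegree_twoHundredSeventyThree_of_char_557 K
  · exact not_holdsInDegree_twoHundredSeventyFour_of_char_557 K
  · exact not_holdsInDegree_twoHundredSeventyFive_of_char_557 K
  · exact not_holdsInDegree_twoHundredSeventySix_of_char_557 K
  · exact not_holdsInDegree_of_choose_modEq_one K 557 (d := 277) (m := 84) (by norm_num) (by norm_num) (by decide)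
  · exact not_holdsInDegree_twoHundredSeventyEight_of_char_557 K
  · exact not_holdsInDegree_of_choose_modEq_one K 557 (d := 279) (m := 10) (by norm_num) (by norm_num) (by decide)
  · exact not_holdsInDegree_twoHundredEighty_of_char_557 K
  · exact not_holdsInDegree_twoHundredEightyOne_of_char_557 K
  · exact not_holdsInDegree_twoHundredEightyTwo_of_char_557 K
  · exact not_holdsInDegree_twoHundredEightyThree_of_char_557 K
  · exact not_holdsInDegree_of_choose_modEq_one K 557 (d := 284) (m := 67) (by norm_num) (by norm_num) (by decide)
  · exact not_holdsInDegree_twoHundredEightyFive_of_char_557 K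
  · exact not_holdsInDegree_twoHundredEightySix_of_char_557 K
  · exact not_holdsInDegree_of_choose_modEq_one K 557 (d := 287) (m := 10) (by norm_num) (by norm_num) (by decide)
  · exact not_holdsInDegree_twoHundredEightyEight_of_char_557 K
  · exact not_holdsInDegree_twoHundredEightyNine_of_char_557 K
  · exact not_holdsInDegree_twoHundredNinety_of_char_557 K
  · exact not_holdsInDegree_of_choose_modEq_one K 557 (d := 291) (m := 110) (by norm_num) (by norm_num) (by decide)
  · exact not_holdsInDegree_twoHundredNinetyTwo_of_char_557 K
  · exact not_holdsInDegree_of_choose_modEq_one K 557 (d := 293) (m := 13) (by norm_num) (by norm_num) (by decide)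
  · exact not_holdsInDegree_twoHundredNinetyFour_of_char_557 K
  · exact not_holdsInDegree_twoHundredNinetyFive_of_char_557 K
  · exact not_holdsInDegree_twoHundredNinetySix_of_char_557 K
  · exact not_holdsInDegree_twoHundredNinetySeven_of_char_557 K
  · exact not_holdsInDegree_of_choose_modEq_one K 557 (d := 298) (m := 37) (by norm_num) (by norm_num) (by decide)
  · exact not_holdsInDegree_twoHundredNinetyNine_of_char_557 K
  · exact not_holdsInDegree_threeHundred_of_char_557 K
  · exact not_holdsInDegree_threeHundredOne_of_char_557 K
  · exact not_holdsInDegree_threeHundredTwo_of_char_557 K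
  · exact not_holdsInDegree_threeHundredThree_of_char_557 K
  · exact not_holdsInDegree_threeHundredFour_of_char_557 K
  · exact not_holdsInDegree_threeHundredFive_of_char_557 K
  · exact not_holdsInDegree_threeHundredSix_of_char_557 K
  · exact not_holdsInDegree_threeHundredSeven_of_char_557 K
  · exact not_holdsInDegree_threeHundredEight_of_char_557 K
  · exact not_holdsInDegree_of_choose_modEq_one K 557 (d := 309) (m := 47) (by norm_num) (by norm_num) (by decide)
  · exact not_holdsInDegree_threeHundredTen_of_char_557 K
  · exact not_holdsInDegree_threeHundredEleven_of_char_557 K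
  · exact not_holdsInDegree_threeHundredTwelve_of_char_557 K
  · exact not_holdsInDegree_threeHundredThirteen_of_char_557 K
  · exact not_holdsInDegree_threeHundredFourteen_of_char_557 K
  · exact not_holdsInDegree_of_choose_modEq_one K 557 (d := 315) (m := 67) (by norm_num) (by norm_num) (by decide)
  · exact not_holdsInDegree_threeHundredSixteen_of_char_557 K
  · exact not_holdsInDegree_threeHundredSeventeen_of_char_557 K
  · exact not_holdsInDegree_threeHundredEighteen_of_char_557 K
  · exact not_holdsInDegree_threeHundredNineteen_of_char_557 K
  · exact not_holdsInDegree_of_choose_modEq_one K 557 (d := 320) (m := 22) (by norm_num) (by norm_num) (by decide)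
  · exact not_holdsInDegree_threeHundredTwentyOne_of_char_557 K
  · exact not_holdsInDegree_threeHundredTwentyTwo_of_char_557 K
  · exact not_holdsInDegree_of_choose_modEq_one K 557 (d := 323) (m := 39) (by norm_num) (by norm_num) (by decide)
  · exact not_holdsInDegree_threeHundredTwentyFour_of_char_557 K
  · exact not_holdsInDegree_threeHundredTwentyFive_of_char_557 K
  · exact not_holdsInDegree_of_choose_modEq_one K 557 (d := 326) (m := 5) (by norm_num) (by norm_num) (by decide)
  · exact not_holdsInDegree_threeHundredTwentySeven_of_char_557 K
  · exact not_holdsInDegree_of_choose_modEq_one K 557 (d := 328) (m := 61) (by norm_num) (by norm_num) (by decide)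
  · exact not_holdsInDegree_threeHundredTwentyNine_of_char_557 K
  · exact not_holdsInDegree_threeHundredThirty_of_char_557 K
  · exact not_holdsInDegree_threeHundredThirtyOne_of_char_557 K
  · exact not_holdsInDegree_threeHundredThirtyTwo_of_char_557 K
  · exact not_holdsInDegree_threeHundredThirtyThree_of_char_557 K
  · exact not_holdsInDegree_threeHundredThirtyFour_of_char_557 K
  · exact not_holdsInDegree_of_choose_modEq_one K 557 (d := 335) (m := 91) (by norm_num) (by norm_num) (by decide)
  · exact not_holdsInDegree_threeHundredThirtySix_of_char_557 K
  · exact not_holdsInDegree_of_choose_modEq_one K 557 (d := 337) (m := 141) (by norm_num) (by norm_num) (by decide)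
  · exact not_holdsInDegree_threeHundredThirtyEight_of_char_557 K
  · exact not_holdsInDegree_threeHundredThirtyNine_of_char_557 K
  · exact not_holdsInDegree_threeHundredForty_of_char_557 K
  · exact not_holdsInDegree_of_choose_modEq_one K 557 (d := 341) (m := 146) (by norm_num) (by norm_num) (by decide)
  · exact not_holdsInDegree_of_choose_modEq_one K 557 (d := 342) (m := 50) (by norm_num) (by norm_num) (by decide)
  · exact not_holdsInDegree_of_choose_modEq_one K 557 (d := 343) (m := 93) (by norm_num) (by norm_num) (by decide)
  · exact not_holdsInDegree_threeHundredFortyFour_of_char_557 K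
  · exact not_holdsInDegree_of_choose_modEq_one K 557 (d := 345) (m := 46) (by norm_num) (by norm_num) (by decide)
  · exact not_holdsInDegree_of_choose_modEq_one K 557 (d := 346) (m := 103) (by norm_num) (by norm_num) (by decide)
  · exact not_holdsInDegree_threeHundredFortySeven_of_char_557 K
  · exact not_holdsInDegree_threeHundredFortyEight_of_char_557 K
  · exact not_holdsInDegree_threeHundredFortyNine_of_char_557 K
  · exact not_holdsInDegree_threeHundredFifty_of_char_557 K
  · exact not_holdsInDegree_threeHundredFiftyOne_of_char_557 K
  · exact not_holdsInDegree_threeHundredFiftyTwo_of_char_557 K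
  · exact not_holdsInDegree_threeHundredFiftyThree_of_char_557 K
  · exact not_holdsInDegree_of_choose_modEq_one K 557 (d := 354) (m := 45) (by norm_num) (by norm_num) (by decide)
  · exact not_holdsInDegree_of_choose_modEq_one K 557 (d := 355) (m := 41) (by norm_num) (by norm_num) (by decide)
  · exact not_holdsInDegree_threeHundredFiftySix_of_char_557 K
  · exact not_holdsInDegree_threeHundredFiftySeven_of_char_557 K
  · exact not_holdsInDegree_threeHundredFiftyEight_of_char_557 K
  · exact not_holdsInDegree_threeHundredFiftyNine_of_char_557 K
  · exact not_holdsInDegree_threeHundredSixty_of_char_557 K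
  · exact not_holdsInDegree_of_choose_modEq_one K 557 (d := 361) (m := 38) (by norm_num) (by norm_num) (by decide)
  · exact not_holdsInDegree_threeHundredSixtyTwo_of_char_557 K
  · exact not_holdsInDegree_of_choose_modEq_one K 557 (d := 363) (m := 20) (by norm_num) (by norm_num) (by decide)
  · exact not_holdsInDegree_of_choose_modEq_one K 557 (d := 364) (m := 19) (by norm_num) (by norm_num) (by decide)
  · exact not_holdsInDegree_threeHundredSixtyFive_of_char_557 K
  · exact not_holdsInDegree_threeHundredSixtySix_of_char_557 K
  · exact not_holdsInDegree_threeHundredSixtySeven_of_char_557 K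
  · exact not_holdsInDegree_of_choose_modEq_one K 557 (d := 368) (m := 40) (by norm_num) (by norm_num) (by decide)
  · exact not_holdsInDegree_threeHundredSixtyNine_of_char_557 K
  · exact not_holdsInDegree_threeHundredSeventy_of_char_557 K
  · exact not_holdsInDegree_threeHundredSeventyOne_of_char_557 K
  · exact not_holdsInDegree_threeHundredSeventyTwo_of_char_557 K
  · exact not_holdsInDegree_threeHundredSeventyThree_of_char_557 K
  · exact not_holdsInDegree_of_choose_modEq_one K 557 (d := 374) (m := 64) (by norm_num) (by norm_num) (by decide)
  · exact not_holdsInDegree_of_choose_modEq_one K 557 (d := 375) (m := 110) (by norm_num) (by norm_num) (by decide)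
  · exact not_holdsInDegree_threeHundredSeventySix_of_char_557 K
  · exact not_holdsInDegree_threeHundredSeventySeven_of_char_557 K
  · exact not_holdsInDegree_of_choose_modEq_one K 557 (d := 378) (m := 39) (by norm_num) (by norm_num) (by decide)
  · exact not_holdsInDegree_threeHundredSeventyNine_of_char_557 K
  · exact not_holdsInDegree_of_choose_modEq_one K 557 (d := 380) (m := 19) (by norm_num) (by norm_num) (by decide)
  · exact not_holdsInDegree_of_choose_modEq_one K 557 (d := 381) (m := 134) (by norm_num) (by norm_num) (by decide)
  · exact not_holdsInDegree_threeHundredEightyTwo_of_char_557 K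
  · exact not_holdsInDegree_threeHundredEightyThree_of_char_557 K
  · exact not_holdsInDegree_of_choose_modEq_one K 557 (d := 384) (m := 60) (by norm_num) (by norm_num) (by decide)
  · exact not_holdsInDegree_of_choose_modEq_one K 557 (d := 385) (m := 36) (by norm_num) (by norm_num) (by decide)
  · exact not_holdsInDegree_threeHundredEightySix_of_char_557 K
  · exact not_holdsInDegree_threeHundredEightySeven_of_char_557 K
  · exact not_holdsInDegree_threeHundredEightyEight_of_char_557 K
  · exact not_holdsInDegree_threeHundredEightyNine_of_char_557 K
  · exact not_holdsInDegree_threeHundredNinety_of_char_557 K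
  · exact not_holdsInDegree_of_choose_modEq_one K 557 (d := 391) (m := 81) (by norm_num) (by norm_num) (by decide)
  · exact not_holdsInDegree_threeHundredNinetyTwo_of_char_557 K
  · exact not_holdsInDegree_threeHundredNinetyThree_of_char_557 K
  · exact not_holdsInDegree_threeHundredNinetyFour_of_char_557 K
  · exact not_holdsInDegree_of_choose_modEq_one K 557 (d := 395) (m := 4) (by norm_num) (by norm_num) (by decide)
  · exact not_holdsInDegree_threeHundredNinetySix_of_char_557 K
  · exact not_holdsInDegree_threeHundredNinetySeven_of_char_557 K
  · exact not_holdsInDegree_of_choose_modEq_one K 557 (d := 398) (m := 195) (by norm_num) (by norm_num) (by decide)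
  · exact not_holdsInDegree_threeHundredNinetyNine_of_char_557 K
  · exact not_holdsInDegree_fourHundred_of_char_557 K
  · exact not_holdsInDegree_of_choose_modEq_one K 557 (d := 401) (m := 83) (by norm_num) (by norm_num) (by decide)
  · exact not_holdsInDegree_fourHundredTwo_of_char_557 K
  · exact not_holdsInDegree_fourHundredThree_of_char_557 K
  · exact not_holdsInDegree_fourHundredFour_of_char_557 K
  · exact not_holdsInDegree_fourHundredFive_of_char_557 K
  · exact not_holdsInDegree_fourHundredSix_of_char_557 K
  · exact not_holdsInDegree_of_choose_modEq_one K 557 (d := 407) (m := 117) (by norm_num) (by norm_num) (by decide)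
  · exact not_holdsInDegree_fourHundredEight_of_char_557 K
  · exact not_holdsInDegree_fourHundredNine_of_char_557 K
  · exact not_holdsInDegree_of_choose_modEq_one K 557 (d := 410) (m := 121) (by norm_num) (by norm_num) (by decide)
  · exact not_holdsInDegree_fourHundredEleven_of_char_557 K
  · exact not_holdsInDegree_fourHundredTwelve_of_char_557 K
  · exact not_holdsInDegree_fourHundredThirteen_of_char_557 K
  · exact not_holdsInDegree_fourHundredFourteen_of_char_557 K
  · exact not_holdsInDegree_of_choose_modEq_one K 557 (d := 415) (m := 196) (by norm_num) (by norm_num) (by decide)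
  · exact not_holdsInDegree_fourHundredSixteen_of_char_557 K
  · exact not_holdsInDegree_fourHundredSeventeen_of_char_557 K
  · exact not_holdsInDegree_of_choose_modEq_one K 557 (d := 418) (m := 103) (by norm_num) (by norm_num) (by decide)
  · exact not_holdsInDegree_of_choose_modEq_one K 557 (d := 419) (m := 98) (by norm_num) (by norm_num) (by decide)
  · exact not_holdsInDegree_fourHundredTwenty_of_char_557 K
  · exact not_holdsInDegree_fourHundredTwentyOne_of_char_557 K
  · exact not_holdsInDegree_fourHundredTwentyTwo_of_char_557 K
  · exact not_holdsInDegree_of_choose_modEq_one K 557 (d := 423) (m := 88) (by norm_num) (by norm_num) (by decide)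
  · exact not_holdsInDegree_fourHundredTwentyFour_of_char_557 K
  · exact not_holdsInDegree_fourHundredTwentyFive_of_char_557 K
  · exact not_holdsInDegree_fourHundredTwentySix_of_char_557 K
  · exact not_holdsInDegree_of_choose_modEq_one K 557 (d := 427) (m := 43) (by norm_num) (by norm_num) (by decide)
  · exact not_holdsInDegree_fourHundredTwentyEight_of_char_557 K
  · exact not_holdsInDegree_of_choose_modEq_one K 557 (d := 429) (m := 26) (by norm_num) (by norm_num) (by decide)
  · exact not_holdsInDegree_fourHundredThirty_of_char_557 K
  · exact not_holdsInDegree_of_choose_modEq_one K 557 (d := 431) (m := 195) (by norm_num) (by norm_num) (by decide)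
  · exact not_holdsInDegree_fourHundredThirtyTwo_of_char_557 K
  · exact not_holdsInDegree_fourHundredThirtyThree_of_char_557 K
  · exact not_holdsInDegree_fourHundredThirtyFour_of_char_557 K
  · exact not_holdsInDegree_fourHundredThirtyFive_of_char_557 K
  · exact not_holdsInDegree_fourHundredThirtySix_of_char_557 K
  · exact not_holdsInDegree_fourHundredThirtySeven_of_char_557 K
  · exact not_holdsInDegree_of_choose_modEq_one K 557 (d := 438) (m := 101) (by norm_num) (by norm_num) (by decide)
  · exact not_holdsInDegree_of_choose_modEq_one K 557 (d := 439) (m := 114) (by norm_num) (by norm_num) (by decide)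
  · exact not_holdsInDegree_fourHundredForty_of_char_557 K
  · exact not_holdsInDegree_of_choose_modEq_one K 557 (d := 441) (m := 150) (by norm_num) (by norm_num) (by decide)
  · exact not_holdsInDegree_fourHundredFortyTwo_of_char_557 K
  · exact not_holdsInDegree_fourHundredFortyThree_of_char_557 K
  · exact not_holdsInDegree_fourHundredFortyFour_of_char_557 K
  · exact not_holdsInDegree_fourHundredFortyFive_of_char_557 K
  · exact not_holdsInDegree_of_choose_modEq_one K 557 (d := 446) (m := 179) (by norm_num) (by norm_num) (by decide)
  · exact not_holdsInDegree_of_choose_modEq_one K 557 (d := 447) (m := 162) (by norm_num) (by norm_num) (by decide)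
  · exact not_holdsInDegree_fourHundredFortyEight_of_char_557 K
  · exact not_holdsInDegree_fourHundredFortyNine_of_char_557 K
  · exact not_holdsInDegree_fourHundredFifty_of_char_557 K
  · exact not_holdsInDegree_of_choose_modEq_one K 557 (d := 451) (m := 221) (by norm_num) (by norm_num) (by decide)
  · exact not_holdsInDegree_fourHundredFiftyTwo_of_char_557 K
  · exact not_holdsInDegree_of_choose_modEq_one K 557 (d := 453) (m := 122) (by norm_num) (by norm_num) (by decide)
  · exact not_holdsInDegree_fourHundredFiftyFour_of_char_557 K
  · exact not_holdsInDegree_of_choose_modEq_one K 557 (d := 455) (m := 60) (by norm_num) (by norm_num) (by decide)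
  · exact not_holdsInDegree_fourHundredFiftySix_of_char_557 K
  · exact not_holdsInDegree_fourHundredFiftySeven_of_char_557 K
  · exact not_holdsInDegree_fourHundredFiftyEight_of_char_557 K
  · exact not_holdsInDegree_fourHundredFiftyNine_of_char_557 K
  · exact not_holdsInDegree_fourHundredSixty_of_char_557 K
  · exact not_holdsInDegree_of_choose_modEq_one K 557 (d := 461) (m := 60) (by norm_num) (by norm_num) (by decide)
  · exact not_holdsInDegree_fourHundredSixtyTwo_of_char_557 K
  · exact not_holdsInDegree_of_choose_modEq_one K 557 (d := 463) (m := 213) (by norm_num) (by norm_num) (by decide)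
  · exact not_holdsInDegree_fourHundredSixtyFour_of_char_557 K
  · exact not_holdsInDegree_of_choose_modEq_one K 557 (d := 465) (m := 20) (by norm_num) (by norm_num) (by decide)
  · exact not_holdsInDegree_fourHundredSixtySix_of_char_557 K
  · exact not_holdsInDegree_fourHundredSixtySeven_of_char_557 K
  · exact not_holdsInDegree_of_choose_modEq_one K 557 (d := 468) (m := 80) (by norm_num) (by norm_num) (by decide)
  · exact not_holdsInDegree_of_choose_modEq_one K 557 (d := 469) (m := 148) (by norm_num) (by norm_num) (by decide)
  · exact not_holdsInDegree_of_choose_modEq_one K 557 (d := 470) (m := 86) (by norm_num) (by norm_num) (by decide)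
  · exact not_holdsInDegree_fourHundredSeventyOne_of_char_557 K
  · exact not_holdsInDegree_fourHundredSeventyTwo_of_char_557 K
  · exact not_holdsInDegree_of_choose_modEq_one K 557 (d := 473) (m := 67) (by norm_num) (by norm_num) (by decide)
  · exact not_holdsInDegree_fourHundredSeventyFour_of_char_557 K
  · exact not_holdsInDegree_of_choose_modEq_one K 557 (d := 475) (m := 165) (by norm_num) (by norm_num) (by decide)
  · exact not_holdsInDegree_of_choose_modEq_one K 557 (d := 476) (m := 41) (by norm_num) (by norm_num) (by decide)
  · exact not_holdsInDegree_fourHundredSeventySeven_of_char_557 K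
  · exact not_holdsInDegree_fourHundredSeventyEight_of_char_557 K
  · exact not_holdsInDegree_of_choose_modEq_one K 557 (d := 479) (m := 156) (by norm_num) (by norm_num) (by decide)
  · exact not_holdsInDegree_fourHundredEighty_of_char_557 K
  · exact not_holdsInDegree_fourHundredEightyOne_of_char_557 K
  · exact not_holdsInDegree_of_choose_modEq_one K 557 (d := 482) (m := 46) (by norm_num) (by norm_num) (by decide)
  · exact not_holdsInDegree_of_choose_modEq_one K 557 (d := 483) (m := 70) (by norm_num) (by norm_num) (by decide)
  · exact not_holdsInDegree_of_choose_modEq_one K 557 (d := 484) (m := 8) (by norm_num) (by norm_num) (by decide)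
  · exact not_holdsInDegree_fourHundredEightyFive_of_char_557 K
  · exact not_holdsInDegree_fourHundredEightySix_of_char_557 K
  · exact not_holdsInDegree_fourHundredEightySeven_of_char_557 K
  · exact not_holdsInDegree_of_choose_modEq_one K 557 (d := 488) (m := 42) (by norm_num) (by norm_num) (by decide)
  · exact not_holdsInDegree_of_choose_modEq_one K 557 (d := 489) (m := 83) (by norm_num) (by norm_num) (by decide)
  · exact not_holdsInDegree_fourHundredNinety_of_char_557 K
  · exact not_holdsInDegree_of_choose_modEq_one K 557 (d := 491) (m := 158) (by norm_num) (by norm_num) (by decide)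
  · exact not_holdsInDegree_of_choose_modEq_one K 557 (d := 492) (m := 182) (by norm_num) (by norm_num) (by decide)
  · exact not_holdsInDegree_fourHundredNinetyThree_of_char_557 K
  · exact not_holdsInDegree_of_choose_modEq_one K 557 (d := 494) (m := 169) (by norm_num) (by norm_num) (by decide)
  · exact not_holdsInDegree_fourHundredNinetyFive_of_char_557 K
  · exact not_holdsInDegree_of_choose_modEq_one K 557 (d := 496) (m := 172) (by norm_num) (by norm_num) (by decide)
  · exact not_holdsInDegree_of_choose_modEq_one K 557 (d := 497) (m := 192) (by norm_num) (by norm_num) (by decide)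
  · exact not_holdsInDegree_fourHundredNinetyEight_of_char_557 K
  · exact not_holdsInDegree_of_choose_modEq_one K 557 (d := 499) (m := 150) (by norm_num) (by norm_num) (by decide)
  · exact not_holdsInDegree_fiveHundred_of_char_557 K
  · exact not_holdsInDegree_fiveHundredOne_of_char_557 K
  · exact not_holdsInDegree_fiveHundredTwo_of_char_557 K
  · exact not_holdsInDegree_fiveHundredThree_of_char_557 K
  · exact not_holdsInDegree_fiveHundredFour_of_char_557 K
  · exact not_holdsInDegree_fiveHundredFive_of_char_557 K
  · exact not_holdsInDegree_of_choose_modEq_one K 557 (d := 506) (m := 214) (by norm_num) (by norm_num) (by decide)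
  · exact not_holdsInDegree_fiveHundredSeven_of_char_557 K
  · exact not_holdsInDegree_of_choose_modEq_one K 557 (d := 508) (m := 68) (by norm_num) (by norm_num) (by decide)
  · exact not_holdsInDegree_of_choose_modEq_one K 557 (d := 509) (m := 247) (by norm_num) (by norm_num) (by decide)
  · exact not_holdsInDegree_of_choose_modEq_one K 557 (d := 510) (m := 74) (by norm_num) (by norm_num) (by decide)
  · exact not_holdsInDegree_fiveHundredEleven_of_char_557 K
  · exact not_holdsInDegree_fiveHundredTwelve_of_char_557 K
  · exact not_holdsInDegree_of_choose_modEq_one K 557 (d := 513) (m := 129) (by norm_num) (by norm_num) (by decide)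
  · exact not_holdsInDegree_of_choose_modEq_one K 557 (d := 514) (m := 68) (by norm_num) (by norm_num) (by decide)
  · exact not_holdsInDegree_of_choose_modEq_one K 557 (d := 515) (m := 12) (by norm_num) (by norm_num) (by decide)
  · exact not_holdsInDegree_of_choose_modEq_one K 557 (d := 516) (m := 188) (by norm_num) (by norm_num) (by decide)
  · exact not_holdsInDegree_of_choose_modEq_one K 557 (d := 517) (m := 233) (by norm_num) (by norm_num) (by decide)
  · exact not_holdsInDegree_fiveHundredEighteen_of_char_557 K
  · exact not_holdsInDegree_of_choose_modEq_one K 557 (d := 519) (m := 13) (by norm_num) (by norm_num) (by decide)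
  · exact not_holdsInDegree_fiveHundredTwenty_of_char_557 K
  · exact not_holdsInDegree_fiveHundredTwentyOne_of_char_557 K
  · exact not_holdsInDegree_fiveHundredTwentyTwo_of_char_557 K
  · exact not_holdsInDegree_fiveHundredTwentyThree_of_char_557 K
  · exact not_holdsInDegree_of_choose_modEq_one K 557 (d := 524) (m := 231) (by norm_num) (by norm_num) (by decide)
  · exact not_holdsInDegree_fiveHundredTwentyFive_of_char_557 K
  · exact not_holdsInDegree_fiveHundredTwentySix_of_char_557 K
  · exact not_holdsInDegree_fiveHundredTwentySeven_of_char_557 K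
  · exact not_holdsInDegree_fiveHundredTwentyEight_of_char_557 K
  · exact not_holdsInDegree_fiveHundredTwentyNine_of_char_557 K
  · exact not_holdsInDegree_of_choose_modEq_one K 557 (d := 530) (m := 37) (by norm_num) (by norm_num) (by decide)
  · exact not_holdsInDegree_fiveHundredThirtyOne_of_char_557 K
  · exact not_holdsInDegree_fiveHundredThirtyTwo_of_char_557 K
  · exact not_holdsInDegree_fiveHundredThirtyThree_of_char_557 K
  · exact not_holdsInDegree_of_choose_modEq_one K 557 (d := 534) (m := 236) (by norm_num) (by norm_num) (by decide)
  · exact not_holdsInDegree_fiveHundredThirtyFive_of_char_557 K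
  · exact not_holdsInDegree_fiveHundredThirtySix_of_char_557 K
  · exact not_holdsInDegree_fiveHundredThirtySeven_of_char_557 K
  · exact not_holdsInDegree_fiveHundredThirtyEight_of_char_557 K
  · exact not_holdsInDegree_fiveHundredThirtyNine_of_char_557 K
  · exact not_holdsInDegree_of_choose_modEq_one K 557 (d := 540) (m := 14) (by norm_num) (by norm_num) (by decide)
  · exact not_holdsInDegree_fiveHundredFortyOne_of_char_557 K
  · exact not_holdsInDegree_of_choose_modEq_one K 557 (d := 542) (m := 16) (by norm_num) (by norm_num) (by decide)
  · exact not_holdsInDegree_of_choose_modEq_one K 557 (d := 543) (m := 37) (by norm_num) (by norm_num) (by decide)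
  · exact not_holdsInDegree_of_choose_modEq_one K 557 (d := 544) (m := 51) (by norm_num) (by norm_num) (by decide)
  · exact not_holdsInDegree_fiveHundredFortyFive_of_char_557 K
  · exact not_holdsInDegree_fiveHundredFortySix_of_char_557 K
  · exact not_holdsInDegree_fiveHundredFortySeven_of_char_557 K
  · exact not_holdsInDegree_of_choose_modEq_one K 557 (d := 548) (m := 72) (by norm_num) (by norm_num) (by decide)
  · exact not_holdsInDegree_fiveHundredFortyNine_of_char_557 K
  · exact not_holdsInDegree_fiveHundredFifty_of_char_557 K
  · exact not_holdsInDegree_fiveHundredFiftyOne_of_char_557 K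
  · exact not_holdsInDegree_fiveHundredFiftyTwo_of_char_557 K
  · exact not_holdsInDegree_fiveHundredFiftyThree_of_char_557 K
  · exact not_holdsInDegree_fiveHundredFiftyFour_of_char_557 K
  · exact not_holdsInDegree_fiveHundredFiftyFive_of_char_557 K
  · exact not_holdsInDegree_of_choose_modEq_one K 557 (d := 556) (m := 2) (by norm_num) (by norm_num) (by decide)

/-- the positive digits `1 ≤ a ≤ 5`: `CA_{a·557^k}` over every field of characteristic `557`. [cite: GrafVonBothmerEtAl2007, Props. 2, 6]
[cite: CastryckLaterveerOunaies2012, Thm. 4] -/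
theorem holdsInDegree_mul_fiveHundredFiftySeven_pow_of_le_five' {a : ℕ} (ha0 : 0 < a) (ha5 : a ≤ 5) (k : ℕ) :
    HoldsInDegree K (a * 557 ^ k) := by
  haveI : Fact (Nat.Prime 557) := ⟨by norm_num⟩
  interval_cases a
  · simpa using holdsInDegree_prime_pow_field K 557 k
  · exact holdsInDegree_two_mul_prime_pow_field K 557 k
  · exact holdsInDegree_three_mul_prime_pow_field K 557 (by norm_num) k
  · exact holdsInDegree_mul_prime_pow_field K 557
      (holdsInDegree_of_le_four_of_charP (AlgebraicClosure K) 557 (by norm_num) le_rfl) k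
  · exact holdsInDegree_five_mul_prime_pow_field K 557 (by norm_num) (by norm_num) (by norm_num) (by norm_num)
      (by norm_num) (by norm_num) (by norm_num) (by norm_num) (by norm_num) k

/-- **characteristic 557, away from the digit `8`**: over every field of characteristic `557` and for every `d ≠ 8·557^k`,
`CA_d ⟺ d = 0 ∨ d = a·557^k` with `1 ≤ a ≤ 7`.  (The degrees `8·557^k` are excluded by hypothesis: no `𝔽_557`-rational-witness
Casas-Alvero octic exists, so the digit `8` is neither refuted nor certified here.) [cite: GrafVonBothmerEtAl2007, Props. 2, 6, 7]
[cite: CastryckLaterveerOunaies2012, Thm. 4] -/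
theorem classification_char_fiveHundredFiftySeven_partial (d : ℕ) (hd : ∀ k : ℕ, d ≠ 8 * 557 ^ k) :
    HoldsInDegree K d ↔ d = 0 ∨ ∃ k a : ℕ, 0 < a ∧ a ≤ 7 ∧ d = a * 557 ^ k := by
  haveI : Fact (Nat.Prime 557) := ⟨by norm_num⟩
  constructor
  · intro h
    rcases Nat.eq_zero_or_pos d with rfl | hd0
    · exact Or.inl rfl
    obtain ⟨k, a, ha0, hap, rfl, ha⟩ := digit_of_holdsInDegree K 557 hd0.ne' h
    refine Or.inr ⟨k, a, ha0, ?_, rfl⟩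
    by_contra hN
    rcases Nat.lt_or_ge a 9 with hlo | hlo
    · obtain rfl : a = 8 := by omega
      exact hd k rfl
    · by_cases h8 : a = 8
      · subst h8
        exact hd k rfl
      · exact not_holdsInDegree_digit_of_char_fiveHundredFiftySeven' K hlo hap h8 ha
  · rintro (rfl | ⟨k, a, ha0, haN, rfl⟩)
    · exact holdsInDegree_zero K
    · rcases Nat.lt_or_ge a 6 with ha | ha
      · exact holdsInDegree_mul_fiveHundredFiftySeven_pow_of_le_five' K ha0 (by omega) k
      · rcases Nat.lt_or_ge a 7 with ha' | ha'
        · obtain rfl : a = 6 := by omega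
          exact holdsInDegree_six_mul_pow_of_char_557' K k
        · obtain rfl : a = 7 := le_antisymm haN ha'
          exact holdsInDegree_seven_mul_pow_of_char_557 (K := K) k

/-- **characteristic 557, complete GIVEN `CA_8`**: if the Casas-Alvero property holds over `K` in the degrees `8·557^k` (for instance once `557` is
certified a good prime of degree `8`, cf. the module docstring — nothing of the kind is proved in this tree), then `CA_d(K) ⟺ d = 0 ∨ d = a·557^k` with
`1 ≤ a ≤ 8`. [cite: GrafVonBothmerEtAl2007, Props. 2, 6, 7] [cite: CastryckLaterveerOunaies2012, Thm. 4] -/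
theorem classification_char_fiveHundredFiftySeven_of_degree_eight (h8 : ∀ k : ℕ, HoldsInDegree K (8 * 557 ^ k)) (d : ℕ) :
    HoldsInDegree K d ↔ d = 0 ∨ ∃ k a : ℕ, 0 < a ∧ a ≤ 8 ∧ d = a * 557 ^ k := by
  haveI : Fact (Nat.Prime 557) := ⟨by norm_num⟩
  constructor
  · intro h
    rcases Nat.eq_zero_or_pos d with rfl | hd0
    · exact Or.inl rfl
    obtain ⟨k, a, ha0, hap, rfl, ha⟩ := digit_of_holdsInDegree K 557 hd0.ne' h
    refine Or.inr ⟨k, a, ha0, ?_, rfl⟩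
    by_contra hN
    rcases Nat.lt_or_ge a 9 with hlo | hlo
    · exact hN (by omega)
    · by_cases h8' : a = 8
      · exact hN (by omega)
      · exact not_holdsInDegree_digit_of_char_fiveHundredFiftySeven' K hlo hap h8' ha
  · rintro (rfl | ⟨k, a, ha0, haN, rfl⟩)
    · exact holdsInDegree_zero K
    · rcases Nat.lt_or_ge a 6 with ha | ha
      · exact holdsInDegree_mul_fiveHundredFiftySeven_pow_of_le_five' K ha0 (by omega) k
      · rcases Nat.lt_or_ge a 7 with ha' | ha'
        · obtain rfl : a = 6 := by omega
          exact holdsInDegree_six_mul_pow_of_char_557' K k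
        · rcases Nat.lt_or_ge a 8 with ha'' | ha''
          · obtain rfl : a = 7 := by omega
            exact holdsInDegree_seven_mul_pow_of_char_557 (K := K) k
          · obtain rfl : a = 8 := le_antisymm haN ha''
            exact h8 k

/-- **characteristic 557, complete GIVEN `¬CA_8`**: if the Casas-Alvero property FAILS over `K` in degree `8`, then (leading-digit reduction, forward half,
any field) it fails in every degree `8·557^k` and `CA_d(K) ⟺ d = 0 ∨ d = a·557^k` with `1 ≤ a ≤ 7`. [cite: GrafVonBothmerEtAl2007, Props. 2, 6, 7]
[cite: CastryckLaterveerOunaies2012, Thm. 4] -/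
theorem classification_char_fiveHundredFiftySeven_of_not_degree_eight (h8 : ¬ HoldsInDegree K 8) (d : ℕ) :
    HoldsInDegree K d ↔ d = 0 ∨ ∃ k a : ℕ, 0 < a ∧ a ≤ 7 ∧ d = a * 557 ^ k := by
  haveI : Fact (Nat.Prime 557) := ⟨by norm_num⟩
  constructor
  · intro h
    rcases Nat.eq_zero_or_pos d with rfl | hd0
    · exact Or.inl rfl
    obtain ⟨k, a, ha0, hap, rfl, ha⟩ := digit_of_holdsInDegree K 557 hd0.ne' h
    refine Or.inr ⟨k, a, ha0, ?_, rfl⟩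
    by_contra hN
    rcases Nat.lt_or_ge a 9 with hlo | hlo
    · obtain rfl : a = 8 := by omega
      exact h8 ha
    · by_cases h8' : a = 8
      · subst h8'
        exact h8 ha
      · exact not_holdsInDegree_digit_of_char_fiveHundredFiftySeven' K hlo hap h8' ha
  · rintro (rfl | ⟨k, a, ha0, haN, rfl⟩)
    · exact holdsInDegree_zero K
    · rcases Nat.lt_or_ge a 6 with ha | ha
      · exact holdsInDegree_mul_fiveHundredFiftySeven_pow_of_le_five' K ha0 (by omega) k
      · rcases Nat.lt_or_ge a 7 with ha' | ha'
        · obtain rfl : a = 6 := by omega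
          exact holdsInDegree_six_mul_pow_of_char_557' K k
        · obtain rfl : a = 7 := le_antisymm haN ha'
          exact holdsInDegree_seven_mul_pow_of_char_557 (K := K) k

/-- the set of Casas-Alvero degrees `≤ 310249` other than `8` and `8·557 = 4456` in characteristic `557`, explicitly (corollary of the classification away
from the digit `8`: [cite: GrafVonBothmerEtAl2007, Prop. 6] with [cite: CastryckLaterveerOunaies2012, Thm. 4] and the digit refutations above). -/
theorem holdsInDegree_iff_mem_of_le_char_fiveHundredFiftySeven_sq' {d : ℕ} (hd : d ≤ 310249) (h8 : d ≠ 8) (h8p : d ≠ 4456) :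
    HoldsInDegree K d ↔ d ∈ ({0, 1, 2, 3, 4, 5, 6, 7, 557, 1114, 1671, 2228, 2785, 3342, 3899, 310249} : Finset ℕ) := by
  have hd' : ∀ k : ℕ, d ≠ 8 * 557 ^ k := by
    intro k
    rcases k with _ | _ | k
    · simpa using h8
    · simpa using h8p
    · intro h
      have : 557 ^ 2 ≤ 557 ^ (k + 1 + 1) := Nat.pow_le_pow_right (by norm_num) (by omega)
      omega
  rw [classification_char_fiveHundredFiftySeven_partial K d hd']
  constructor
  · rintro (rfl | ⟨k, a, ha0, haN, rfl⟩)
    · decide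
    · rcases k with _ | _ | _ | k
      · interval_cases a <;> decide
      · interval_cases a <;> decide
      · interval_cases a <;> simp_all
      · exfalso
        have : 557 ^ 3 ≤ a * 557 ^ (k + 1 + 1 + 1) :=
          le_trans (Nat.pow_le_pow_right (by norm_num) (by omega)) (Nat.le_mul_of_pos_left _ ha0)
        omega
  · intro h
    simp only [Finset.mem_insert, Finset.mem_singleton] at h
    rcases h with rfl | rfl | rfl | rfl | rfl | rfl | rfl | rfl | rfl | rfl | rfl | rfl | rfl | rfl | rfl | rfl
    · exact Or.inl rfl
    · exact Or.inr ⟨0, 1, by norm_num, by norm_num, by norm_num⟩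
    · exact Or.inr ⟨0, 2, by norm_num, by norm_num, by norm_num⟩
    · exact Or.inr ⟨0, 3, by norm_num, by norm_num, by norm_num⟩
    · exact Or.inr ⟨0, 4, by norm_num, by norm_num, by norm_num⟩
    · exact Or.inr ⟨0, 5, by norm_num, by norm_num, by norm_num⟩
    · exact Or.inr ⟨0, 6, by norm_num, by norm_num, by norm_num⟩
    · exact Or.inr ⟨0, 7, by norm_num, by norm_num, by norm_num⟩
    · exact Or.inr ⟨1, 1, by norm_num, by norm_num, by norm_num⟩
    · exact Or.inr ⟨1, 2, by norm_num, by norm_num, by norm_num⟩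
    · exact Or.inr ⟨1, 3, by norm_num, by norm_num, by norm_num⟩
    · exact Or.inr ⟨1, 4, by norm_num, by norm_num, by norm_num⟩
    · exact Or.inr ⟨1, 5, by norm_num, by norm_num, by norm_num⟩
    · exact Or.inr ⟨1, 6, by norm_num, by norm_num, by norm_num⟩
    · exact Or.inr ⟨1, 7, by norm_num, by norm_num, by norm_num⟩
    · exact Or.inr ⟨2, 1, by norm_num, by norm_num, by norm_num⟩

end CharFiveHundredFiftySevenPartial

end Literature.Algebra.Polynomial.CasasAlvero
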